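import Mathlib
import Summits.NavierStokesRegularity.NavierStokesRegularity.Theorems.EulerZoomLiouvillePowerGaugeEulerLiouvilleWeakTraceGeneral
import Literature.Analysis.FluidPDE.PressurePoisson
import Literature.Analysis.FluidPDE.WholeSpaceIBP
import HarnessLib

/-!
# t60-ΠLOG piece S1 (nsreg-p2 ROUND-58, `r58/Sketch58c.lean` c6fe466b7b48535d): THE WEAK PRESSURE POISSON EQUATION OF A PROFILE
# `NsregP2.R58c.WeakPressureEquation` VERBATIM (`SolvesPressurePoisson` δ-unfolded)

Seat ns-ezl-w2 g7 (KEY S58c-1 of LEAD 19832 ns-typeII-p2 g16), `--supports stmt-NavierStokesRegularity-19832 --as helper`.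

`PressureSeam.weakPressureEquation`: for a classical self-similar Euler profile `(V, P)` with ANY exponent `γ` and centre `0`, and every
test function `φ ∈ C^∞_c(ℝ³)`, `∫ P Δφ = −∫ D²φ(V, V)`.  Proof (Sketch58c §1): the tree's weak profile identity with pressure
`WeakTrace.weakProfileIdentity_pressure` at `ψ = ∇φ`: `(1 − 4γ)∫⟪V, ∇φ⟫ = ∫⟪V, D(∇φ)[γy + V]⟫ + ∫ P div ∇φ`; `div ∇φ = Δφ`
(`divergence_gradient`); `∫⟪V, ∇φ⟫ = 0` and `∫ D²φ(y)[y, V] = ∫⟪V, ∇(⟪y, ∇φ⟫ − φ)⟫ = 0` because `div V = 0` (Leray's integration by parts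
`integral_mul_divergence_add_eq_zero_left`); `⟪V, D(∇φ)[V]⟫ = D²φ(V, V)`.

HONEST FRAMING: a portrait-instrument piece (pressure budget at scale, t60-ΠLOG) about HYPOTHETICAL profiles; nothing about the crux E
(`PowerGaugeEulerLiouville`, stmt 19832, OPEN) or NS regularity is proved; MODEL-lattice crux class; not E.
[nsreg-p2 R58c §1 S1; cite: Leray1934, §6 (1.11) p. 203 (the IBP); folklore]
-/

noncomputable section

set_option linter.dupNamespace false

open MeasureTheory Set Filter Topology Metric Function InnerProductSpace
open scoped ENNReal NNReal RealInnerProductSpace Topology Laplacian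

namespace Summit.NavierStokesRegularity.NavierStokesRegularity.Theorems.PowerGaugeEulerLiouville.PressureSeam

open Literature.Analysis Literature.Analysis.FluidPDE

/-- `⟪v, ∇g(y)⟫ = Dg(y)[v]`. [folklore] -/
theorem inner_gradient_eq_fderiv {g : (EuclideanSpace ℝ (Fin 3)) → ℝ} (y v : (EuclideanSpace ℝ (Fin 3))) : ⟪v, gradient g y⟫ = fderiv ℝ g y v := by
  rw [gradient, real_inner_comm, InnerProductSpace.toDual_symm_apply]

/-- `⟪v, D(∇φ)(y)[h]⟫ = D²φ(y)[h][v]` for `φ ∈ C²`. [folklore] -/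
theorem inner_fderiv_gradient_apply {φ : (EuclideanSpace ℝ (Fin 3)) → ℝ} (hφ : ContDiff ℝ 2 φ) (y h v : (EuclideanSpace ℝ (Fin 3))) :
    ⟪v, fderiv ℝ (gradient φ) y h⟫ = fderiv ℝ (fderiv ℝ φ) y h v := by
  have hφ' : ContDiff ℝ 1 (fderiv ℝ φ) := hφ.fderiv_right (m := 1) le_rfl
  have hgrad : ContDiff ℝ 1 (gradient φ) := (InnerProductSpace.toDual ℝ (EuclideanSpace ℝ (Fin 3))).symm.contDiff.comp hφ'
  have hgd : DifferentiableAt ℝ (gradient φ) y := hgrad.differentiable one_ne_zero y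
  have h1 : ⟪v, fderiv ℝ (gradient φ) y h⟫ = fderiv ℝ (fun z => ⟪v, gradient φ z⟫) y h := by
    rw [fderiv_inner_apply ℝ (differentiableAt_const _) hgd, fderiv_fun_const]
    simp
  have h2 : (fun z => ⟪v, gradient φ z⟫) = fun z => fderiv ℝ φ z v := by
    funext z
    rw [gradient, real_inner_comm, InnerProductSpace.toDual_symm_apply]
  have hd : DifferentiableAt ℝ (fderiv ℝ φ) y := hφ'.differentiable one_ne_zero y
  rw [h1, h2, fderiv_clm_apply hd (differentiableAt_const v)]
  simp

/-- The Euler vector field identity `D(⟪y, ∇φ⟫ − φ)(y)[h] = D²φ(y)[h][y]`. [folklore] -/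
theorem fderiv_euler_apply {φ : (EuclideanSpace ℝ (Fin 3)) → ℝ} (hφ : ContDiff ℝ 2 φ) (y h : (EuclideanSpace ℝ (Fin 3))) :
    fderiv ℝ (fun z : (EuclideanSpace ℝ (Fin 3)) => fderiv ℝ φ z z - φ z) y h = fderiv ℝ (fderiv ℝ φ) y h y := by
  have hφ' : ContDiff ℝ 1 (fderiv ℝ φ) := hφ.fderiv_right (m := 1) le_rfl
  have hd : DifferentiableAt ℝ (fderiv ℝ φ) y := hφ'.differentiable one_ne_zero y
  have hdφ : DifferentiableAt ℝ φ y := hφ.differentiable (by norm_num) y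
  have h2 : HasFDerivAt (fun z : (EuclideanSpace ℝ (Fin 3)) => fderiv ℝ φ z z - φ z)
      (((fderiv ℝ φ y).comp (ContinuousLinearMap.id ℝ (EuclideanSpace ℝ (Fin 3))) + (fderiv ℝ (fderiv ℝ φ) y).flip y) - fderiv ℝ φ y) y :=
    (hd.hasFDerivAt.clm_apply (hasFDerivAt_id y)).sub hdφ.hasFDerivAt
  rw [h2.fderiv]
  simp

/-- **`∫⟪V, ∇θ⟫ = 0`** for `V ∈ C¹` divergence free and `θ ∈ C¹_c` (Leray's integration by parts). [cite: Leray1934, §6 (1.11) p. 203] -/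
theorem integral_inner_gradient_eq_zero {V : (EuclideanSpace ℝ (Fin 3)) → (EuclideanSpace ℝ (Fin 3))} (hV : ContDiff ℝ 1 V) (hdiv : VectorCalculus.IsDivFree V)
    {θ : (EuclideanSpace ℝ (Fin 3)) → ℝ} (hθ : ContDiff ℝ 1 θ) (hθc : HasCompactSupport θ) : ∫ y, ⟪V y, gradient θ y⟫ = 0 := by
  have h := integral_mul_divergence_add_eq_zero_left hθ hV hθc
  have h0 : ∫ y, θ y * VectorCalculus.divergence V y = 0 := by
    simp [hdiv _]
  rw [h0, zero_add] at h
  exact h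

/-- ★ **S1 `NsregP2.R58c.WeakPressureEquation` VERBATIM** (`SolvesPressurePoisson V P` δ-unfolded): the pressure of a classical self-similar
Euler profile (any exponent `γ`, centre `0`) solves `−ΔP = D² : (V ⊗ V)` weakly — `∫ P Δφ = −∫ D²φ(V, V)` for every `φ ∈ C^∞_c`.
[nsreg-p2 R58c §1 S1; cite: Leray1934, §6 (1.11) p. 203] -/
theorem weakPressureEquation :
    ∀ (γ : ℝ) (V : (EuclideanSpace ℝ (Fin 3)) → (EuclideanSpace ℝ (Fin 3))) (P : (EuclideanSpace ℝ (Fin 3)) → ℝ), IsSelfSimilarEulerProfile γ 0 V P →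
      ∀ φ : (EuclideanSpace ℝ (Fin 3)) → ℝ, ContDiff ℝ (⊤ : ℕ∞) φ → HasCompactSupport φ →
        ∫ x, P x * (Δ φ) x = -∫ x, fderiv ℝ (fderiv ℝ φ) x (V x) (V x) := by
  intro γ V P hprof φ hφ hφc
  have hV1 : ContDiff ℝ 1 V := hprof.contDiff_velocity.of_le one_le_two
  have hVc : Continuous V := hV1.continuous
  have hφ2 : ContDiff ℝ 2 φ := hφ.of_le (WithTop.coe_le_coe.2 le_top)
  have hφ1 : ContDiff ℝ 1 φ := hφ2.of_le one_le_two
  have hφ' : ContDiff ℝ 1 (fderiv ℝ φ) := hφ2.fderiv_right (m := 1) le_rfl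
  have hD2c : Continuous (fderiv ℝ (fderiv ℝ φ)) := hφ'.continuous_fderiv one_ne_zero
  -- the test field `ψ = ∇φ`
  have hψ : ContDiff ℝ 1 (gradient φ) := (InnerProductSpace.toDual ℝ (EuclideanSpace ℝ (Fin 3))).symm.contDiff.comp hφ'
  have hψc : HasCompactSupport (gradient φ) :=
    (hφc.fderiv (𝕜 := ℝ)).comp_left (g := (InnerProductSpace.toDual ℝ (EuclideanSpace ℝ (Fin 3))).symm) (map_zero _)
  have hmain := WeakTrace.weakProfileIdentity_pressure hprof hψ hψc
  -- (a) `∫⟪V, ∇φ⟫ = 0`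
  have ha : ∫ y, ⟪V y, gradient φ y⟫ = 0 := integral_inner_gradient_eq_zero hV1 hprof.divFree hφ1 hφc
  -- (b) `div ∇φ = Δφ`
  have hb : ∫ y, P y * VectorCalculus.divergence (gradient φ) y = ∫ y, P y * (Δ φ) y :=
    integral_congr_ae (ae_of_all _ fun y => by beta_reduce; rw [divergence_gradient hφ2 y])
  -- (c) the transport term splits
  have hK2 : HasCompactSupport (fderiv ℝ (fderiv ℝ φ)) := (hφc.fderiv (𝕜 := ℝ)).fderiv (𝕜 := ℝ)
  have hIlin : Integrable (fun y : (EuclideanSpace ℝ (Fin 3)) => fderiv ℝ (fderiv ℝ φ) y y (V y)) := by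
    refine ((hD2c.clm_apply continuous_id).clm_apply hVc).integrable_of_hasCompactSupport (hK2.mono fun y hy => ?_)
    contrapose! hy
    simp only [Function.mem_support, not_not] at hy ⊢
    simp [hy]
  have hIquad : Integrable (fun y : (EuclideanSpace ℝ (Fin 3)) => fderiv ℝ (fderiv ℝ φ) y (V y) (V y)) := by
    refine ((hD2c.clm_apply hVc).clm_apply hVc).integrable_of_hasCompactSupport (hK2.mono fun y hy => ?_)
    contrapose! hy
    simp only [Function.mem_support, not_not] at hy ⊢
    simp [hy]
  have hc : ∫ y, ⟪V y, fderiv ℝ (gradient φ) y (γ • y + V y)⟫ =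
      γ * (∫ y, fderiv ℝ (fderiv ℝ φ) y y (V y)) + ∫ y, fderiv ℝ (fderiv ℝ φ) y (V y) (V y) := by
    have e : ∀ y, ⟪V y, fderiv ℝ (gradient φ) y (γ • y + V y)⟫ =
        γ * fderiv ℝ (fderiv ℝ φ) y y (V y) + fderiv ℝ (fderiv ℝ φ) y (V y) (V y) := fun y => by
      rw [inner_fderiv_gradient_apply hφ2, map_add, map_smul]
      rfl
    simp_rw [e]
    rw [integral_add (hIlin.const_mul γ) hIquad, integral_const_mul]
  -- (d) `∫ D²φ(y)[y, V] = ∫⟪V, ∇θ⟫ = 0`, `θ = ⟪y, ∇φ⟫ − φ`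
  have hd : ∫ y, fderiv ℝ (fderiv ℝ φ) y y (V y) = 0 := by
    have hθ : ContDiff ℝ 1 fun z : (EuclideanSpace ℝ (Fin 3)) => fderiv ℝ φ z z - φ z := (hφ'.clm_apply contDiff_id).sub hφ1
    have hθc : HasCompactSupport fun z : (EuclideanSpace ℝ (Fin 3)) => fderiv ℝ φ z z - φ z := by
      refine HasCompactSupport.sub ((hφc.fderiv (𝕜 := ℝ)).mono fun y hy => ?_) hφc
      contrapose! hy
      simp only [Function.mem_support, not_not] at hy ⊢
      simp [hy]
    have h0 := integral_inner_gradient_eq_zero hV1 hprof.divFree hθ hθc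
    rw [← h0]
    refine integral_congr_ae (ae_of_all _ fun y => ?_)
    beta_reduce
    have hsymm : fderiv ℝ (fderiv ℝ φ) y (V y) y = fderiv ℝ (fderiv ℝ φ) y y (V y) :=
      (hφ2.contDiffAt.isSymmSndFDerivAt (by simp)) (V y) y
    rw [inner_gradient_eq_fderiv, fderiv_euler_apply hφ2, hsymm]
  rw [ha, hb, hc, hd, mul_zero, mul_zero, zero_add] at hmain
  linarith

end Summit.NavierStokesRegularity.NavierStokesRegularity.Theorems.PowerGaugeEulerLiouville.PressureSeam

end
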